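import Summits.Ventures.PercRepro.ProfileGapMonoThresholdGeneric

/-!
# PercRepro — THE GENERIC DELETION LEMMA OF THE THRESHOLD FAMILY HOLDS ONE LEVEL LOWER (p5, gen 25;
`proofs/P5-GM1.md` §25; announced INBOX before typing)

`delMonoT_of_genericQ` (`ProfileGapMonoThresholdGeneric`) asks for `GenericQ N z q`.  Its proof applies the
genericity only to sets of rank `≤ q − 1` — the `z`-free rank-`(q−1)` sets `B`, the sets `B'` with
`ρ_{N／z}(B') = q − 2`, and, in the supply bound, the sets `S'` with `ρ_{N／z}(S') = q − 1` and `ρ_N(S') = q − 1` —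
except for the sets `S'` with `ρ_{N／z}(S') = q − 1` and `ρ_N(S') = q`, which need NO genericity at all: if such an
`S'` has `ρ(E' ∖ S') = t − 1` (so that `S' ∪ z ∉ T_t(N)`), then `S'` ITSELF is a lost set — a `z`-free member of
`T_t(N)` (`ρ(E ∖ S') = ρ((E' ∖ S') ∪ z) ≥ t`) that is not in `T_t(N ∖ z)` — and `S' ↦ S'` there, `S' ↦ S' ∪ z`
otherwise, is injective into `T_t(N) ∖ T_t(N ∖ z)`.  So every lemma of the generic module holds with a genericity
LEVEL `k ≥ q − 1`, in particular with `GenericQ N z (q − 1)`, and the hard class of the threshold family shrinks from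
«no `q`-generic point» to «no `(q−1)`-generic point» (every point in a cocircuit `D` with `ρ(D ∖ z) ≤ q − 1`).
Data (every matroid on `≤ 8` elements, every non-loop `z`, every `q ≥ 2`, every `t ≥ q − 1`): at every
`(q−1)`-generic point the supply bound and `DelMonoT` hold (`17,505 / 17,505` instances at each offset `−1, 0, 1`);
at the points with `m(z) = q − 1` the supply bound fails (`237` instances at offset `0`) — the level is sharp for
this proof.

* `thresholdTerm_delete_of_genericLevel`, `thresholdSum_delete_of_genericLevel`,
  `thresholdTerm_insert_of_genericLevel`, `thresholdSum_eq_delete_add_contract_of_genericLevel`,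
  **`card_levelSetCoQ_delete_add_le_of_genericLevel`** (the supply bound with the lost-set branch),
  **`delMonoT_of_genericLevel`**, **`delMonoT_of_genericQ_pred`**.
-/

open scoped Matroid

namespace PercRepro.Cogirth

open Finset ThmH Skew Shadow Profile

variable {α : Type} [DecidableEq α] {M : Matroid α} [M.Finite]

section ThresholdGenericLevel

variable {N : Matroid α} [N.Finite] {z : α} {q t k : ℕ}

/-- At a point `z` generic at a level `k ≥ q − 1`, the complement rank of a rank-`(q−1)` set `B ∌ z` is the same in
`N ∖ z` and in `N` (`z` lies in the closure of `E ∖ z ∖ B`). -/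
theorem thresholdTerm_delete_of_genericLevel (hz : z ∈ gr N) (hg : GenericQ N z k) (hk : q - 1 ≤ k)
    {B : Finset α} (hB : B ∈ Rq N (q - 1)) (hzB : z ∉ B) :
    (if t + 1 ≤ rk (N ＼ ({z} : Set α)) (gr (N ＼ ({z} : Set α)) \ B) then
        rk (N ＼ ({z} : Set α)) (gr (N ＼ ({z} : Set α)) \ B) else 0) =
      (if t + 1 ≤ rk N (gr N \ B) then rk N (gr N \ B) else 0) := by
  rw [mem_Rq] at hB
  obtain ⟨hBg, hBr⟩ := hB
  have hrkB : rk N B = q - 1 := rk_eq_of_eRk_eq_cq hBr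
  have hBE : B ⊆ (gr N).erase z := subset_erase.2 ⟨hBg, hzB⟩
  have hX : (gr N).erase z \ B ⊆ (gr N).erase z := sdiff_subset
  have hcl : z ∈ clF N ((gr N).erase z \ B) := hg B hBE (by omega)
  have h1 : rk (N ＼ ({z} : Set α)) (gr (N ＼ ({z} : Set α)) \ B) = rk N ((gr N).erase z \ B) := by
    rw [gr_delete']
    exact rk_delete hX
  have h2 : gr N \ B = insert z ((gr N).erase z \ B) := by
    ext x
    simp only [mem_sdiff, mem_insert, mem_erase]
    constructor
    · rintro ⟨hx, hxB⟩
      by_cases hxz : x = z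
      · exact Or.inl hxz
      · exact Or.inr ⟨⟨hxz, hx⟩, hxB⟩
    · rintro (rfl | ⟨⟨_, hx⟩, hxB⟩)
      · exact ⟨hz, hzB⟩
      · exact ⟨hx, hxB⟩
  have h3 : rk N (gr N \ B) = rk N ((gr N).erase z \ B) := by
    rw [h2, rk_insert_eq hz (hX.trans (erase_subset _ _)), if_pos hcl]
  rw [h1, h3]

/-- At a point generic at a level `k ≥ q − 1` the threshold demand of `N ∖ z` is the threshold demand of the sets
of `N` avoiding `z`. -/
theorem thresholdSum_delete_of_genericLevel (hz : z ∈ gr N) (hg : GenericQ N z k) (hk : q - 1 ≤ k) :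
    thresholdSum (N ＼ ({z} : Set α)) q t =
      ∑ B ∈ (Rq N (q - 1)).filter (fun B => z ∉ B),
        (if t + 1 ≤ rk N (gr N \ B) then rk N (gr N \ B) else 0) := by
  unfold thresholdSum
  rw [Rq_delete_eq_filter]
  refine sum_congr rfl (fun B hB => ?_)
  rw [mem_filter] at hB
  exact thresholdTerm_delete_of_genericLevel hz hg hk hB.1 hB.2

/-- At a non-loop `z` generic at a level `k ≥ q − 1`, for a rank-`(q−2)` set `B'` of `N ／ z`: the threshold demand
of `B' ∪ z` in `N` is `[t ≤ r] · (r + 1)` with `r := ρ_{N／z}(E' ∖ B')` (`2 ≤ q`; `ρ_N(B') ≤ q − 1`). -/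
theorem thresholdTerm_insert_of_genericLevel (hzI : N.Indep {z}) (hg : GenericQ N z k) (hk : q - 1 ≤ k)
    (hq : 2 ≤ q) {B' : Finset α} (hB' : B' ∈ Rq (N ／ ({z} : Set α)) (q - 2)) :
    (if t + 1 ≤ rk N (gr N \ insert z B') then rk N (gr N \ insert z B') else 0) =
      (if t ≤ rk (N ／ ({z} : Set α)) (gr (N ／ ({z} : Set α)) \ B') then
        rk (N ／ ({z} : Set α)) (gr (N ／ ({z} : Set α)) \ B') + 1 else 0) := by
  have hz : z ∈ gr N := mem_gr_of_indep hzI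
  rw [mem_Rq, gr_contract'] at hB'
  obtain ⟨hB'g, hB'r⟩ := hB'
  have hr' : rk (N ／ ({z} : Set α)) B' = q - 2 := rk_eq_of_eRk_eq_cq hB'r
  -- `ρ_N(B') ≤ q − 1`: contracting lowers the rank by at most one
  have hrkB' : rk N B' ≤ q - 1 := by
    have h := rk_contract_add_one hzI hB'g
    rw [hr'] at h
    have h2 := rk_mono' (M := N) (subset_insert z B')
    omega
  have hY : (gr N).erase z \ B' ⊆ (gr N).erase z := sdiff_subset
  have hcl : z ∈ clF N ((gr N).erase z \ B') := hg B' hB'g (by omega)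
  have h1 : gr N \ insert z B' = (gr N).erase z \ B' := by
    ext x
    simp only [mem_sdiff, mem_insert, mem_erase, not_or]
    tauto
  have h2 : rk N ((gr N).erase z \ B') = rk (N ／ ({z} : Set α)) ((gr N).erase z \ B') + 1 := by
    rw [rk_contract_add_one hzI hY, rk_insert_eq hz (hY.trans (erase_subset _ _)), if_pos hcl]
  rw [h1, gr_contract', h2]
  by_cases hle : t ≤ rk (N ／ ({z} : Set α)) ((gr N).erase z \ B')
  · rw [if_pos (by omega), if_pos hle]
  · rw [if_neg (by omega), if_neg hle]

/-- **The threshold demand at a point generic at a level `k ≥ q − 1` splits**: `thresholdSum N q t =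
thresholdSum (N ∖ z) q t + thresholdSum (N ／ z) (q−1) (t−1) + #{B' : ρ_{N／z}(B') = q−2, ρ_{N／z}(E' ∖ B') ≥ t}`
(`2 ≤ q`, `1 ≤ t`). -/
theorem thresholdSum_eq_delete_add_contract_of_genericLevel (hzI : N.Indep {z}) (hg : GenericQ N z k)
    (hk : q - 1 ≤ k) (hq : 2 ≤ q) (ht : 1 ≤ t) :
    thresholdSum N q t =
      thresholdSum (N ＼ ({z} : Set α)) q t +
        (thresholdSum (N ／ ({z} : Set α)) (q - 1) (t - 1) +
          ((Rq (N ／ ({z} : Set α)) (q - 2)).filter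
            (fun B' => t ≤ rk (N ／ ({z} : Set α)) (gr (N ／ ({z} : Set α)) \ B'))).card) := by
  have hz : z ∈ gr N := mem_gr_of_indep hzI
  have e1 : q - 1 - 1 = q - 2 := by omega
  have e2 : t - 1 + 1 = t := by omega
  have hsplit : thresholdSum N q t =
      ∑ B ∈ (Rq N (q - 1)).filter (fun B => z ∈ B),
          (if t + 1 ≤ rk N (gr N \ B) then rk N (gr N \ B) else 0) +
        ∑ B ∈ (Rq N (q - 1)).filter (fun B => z ∉ B),
          (if t + 1 ≤ rk N (gr N \ B) then rk N (gr N \ B) else 0) := by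
    unfold thresholdSum
    rw [sum_filter_add_sum_filter_not]
  have hthru : ∑ B ∈ (Rq N (q - 1)).filter (fun B => z ∈ B),
      (if t + 1 ≤ rk N (gr N \ B) then rk N (gr N \ B) else 0) =
      thresholdSum (N ／ ({z} : Set α)) (q - 1) (t - 1) +
        ((Rq (N ／ ({z} : Set α)) (q - 2)).filter
          (fun B' => t ≤ rk (N ／ ({z} : Set α)) (gr (N ／ ({z} : Set α)) \ B'))).card := by
    rw [sum_Rq_filter_mem_contract hzI (by omega : 1 ≤ q - 1), e1]
    rw [sum_congr rfl (fun B' hB' => thresholdTerm_insert_of_genericLevel (t := t) hzI hg hk hq hB')]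
    unfold thresholdSum
    rw [e1, e2, card_filter, ← sum_add_distrib]
    refine sum_congr rfl (fun B' _ => ?_)
    split_ifs <;> omega
  rw [hsplit, hthru, thresholdSum_delete_of_genericLevel (t := t) hz hg hk]
  ring

/-- **The supply bound at a non-loop point generic at a level `k ≥ q − 1`, at every co-rank threshold `t ≥ 1`**:
`#T_t(N ∖ z) + #T'_{t−1}(N ／ z) ≤ #T_t(N)`.  The sets of `N ∖ z` are sets of `N`; a co-rank-`(t−1)` rank-`(q−1)`
set `S'` of `N ／ z` goes to `S' ∪ z` when `S' ∪ z` has co-rank `≥ t` in `N` — always when `ρ_N(S') = q − 1` (the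
genericity), and when `ρ_N(S') = q` unless `ρ(E' ∖ S') = t − 1` — and to the LOST set `S'` itself in the remaining
case (`S' ∈ T_t(N)` since `ρ(E ∖ S') = ρ((E' ∖ S') ∪ z) ≥ t`, and `S' ∉ T_t(N ∖ z)`). -/
theorem card_levelSetCoQ_delete_add_le_of_genericLevel (hzI : N.Indep {z}) (hg : GenericQ N z k)
    (hk : q - 1 ≤ k) (hq : 1 ≤ q) (ht : 1 ≤ t) :
    (levelSetCoQ (N ＼ ({z} : Set α)) t q).card + (levelSetCoQ (N ／ ({z} : Set α)) (t - 1) (q - 1)).card ≤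
      (levelSetCoQ N t q).card := by
  have hz : z ∈ gr N := mem_gr_of_indep hzI
  set T' := levelSetCoQ (N ／ ({z} : Set α)) (t - 1) (q - 1) with hT'
  -- the lost-set branch: `S'` of `N`-rank `q` whose complement in `E ∖ z` has rank `< t`
  let lost : Finset α → Prop := fun S' => rk N S' = q ∧ rk N ((gr N).erase z \ S') < t
  let f : Finset α → Finset α := fun S' => if lost S' then S' else insert z S'
  -- basic facts about a member of `T'`
  have hmem : ∀ S' ∈ T', S' ⊆ (gr N).erase z ∧ rk (N ／ ({z} : Set α)) S' = q - 1 ∧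
      t ≤ rk N (insert z ((gr N).erase z \ S')) := by
    intro S' hS'
    rw [hT', mem_levelSetCoQ, gr_contract'] at hS'
    obtain ⟨⟨hS'g, hS'r⟩, hS'c⟩ := hS'
    have hr' : rk (N ／ ({z} : Set α)) S' = q - 1 := rk_eq_of_eRk_eq_cq hS'r
    have hY : (gr N).erase z \ S' ⊆ (gr N).erase z := sdiff_subset
    have h2 := rk_contract_add_one hzI hY
    exact ⟨hS'g, hr', by omega⟩
  -- `ρ_N(S') ≤ q` and `ρ_N(S' ∪ z) = q`
  have hrk : ∀ S' ∈ T', rk N S' ≤ q ∧ rk N (insert z S') = q := by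
    intro S' hS'
    obtain ⟨hS'g, hr', _⟩ := hmem S' hS'
    have h := rk_contract_add_one hzI hS'g
    rw [hr'] at h
    have h2 := rk_mono' (M := N) (subset_insert z S')
    exact ⟨by omega, by omega⟩
  -- the complement of a `z`-free set in `gr N`
  have hcomp : ∀ S' : Finset α, z ∉ S' → gr N \ S' = insert z ((gr N).erase z \ S') := by
    intro S' hzS'
    ext x
    simp only [mem_sdiff, mem_insert, mem_erase]
    constructor
    · rintro ⟨hx, hxS⟩
      by_cases hxz : x = z
      · exact Or.inl hxz
      · exact Or.inr ⟨⟨hxz, hx⟩, hxS⟩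
    · rintro (rfl | ⟨⟨_, hx⟩, hxS⟩)
      · exact ⟨hz, hzS'⟩
      · exact ⟨hx, hxS⟩
  -- the image lies in `T_t(N)`
  have himage : T'.image f ⊆ levelSetCoQ N t q := by
    intro S hS
    rw [mem_image] at hS
    obtain ⟨S', hS', rfl⟩ := hS
    obtain ⟨hS'g, hr', hc⟩ := hmem S' hS'
    obtain ⟨hle, hins⟩ := hrk S' hS'
    have hzS' : z ∉ S' := fun h => (mem_erase.1 (hS'g h)).1 rfl
    have hY : (gr N).erase z \ S' ⊆ (gr N).erase z := sdiff_subset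
    show (if lost S' then S' else insert z S') ∈ levelSetCoQ N t q
    by_cases hl : lost S'
    · -- the lost set `S'` itself
      rw [if_pos hl]
      obtain ⟨hrq, _⟩ := hl
      rw [mem_levelSetCoQ]
      refine ⟨⟨hS'g.trans (erase_subset _ _), eRk_eq_of_rk_eq_cq hrq⟩, ?_⟩
      rw [hcomp S' hzS']
      exact hc
    · -- `S' ∪ z`, of co-rank `≥ t`
      rw [if_neg hl]
      have hgood : t ≤ rk N ((gr N).erase z \ S') := by
        by_cases hrq : rk N S' = q
        · -- not lost: the complement in `E ∖ z` has rank `≥ t`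
          by_contra hlt
          exact hl ⟨hrq, by omega⟩
        · -- `ρ_N(S') ≤ q − 1 ≤ k`: the genericity puts `z` in the closure of the complement
          have hcl : z ∈ clF N ((gr N).erase z \ S') := hg S' hS'g (by omega)
          have h3 : rk N (insert z ((gr N).erase z \ S')) = rk N ((gr N).erase z \ S') := by
            rw [rk_insert_eq hz (hY.trans (erase_subset _ _)), if_pos hcl]
          omega
      exact mem_levelSetCoQ_of_generic_good hzI (q := t) (u := q) hq hS' hgood
  -- injectivity
  have hinj : Set.InjOn f (T' : Set (Finset α)) := by
    intro S₁ hS₁ S₂ hS₂ heq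
    have hz₁ : z ∉ S₁ := fun h => (mem_erase.1 ((hmem S₁ hS₁).1 h)).1 rfl
    have hz₂ : z ∉ S₂ := fun h => (mem_erase.1 ((hmem S₂ hS₂).1 h)).1 rfl
    change (if lost S₁ then S₁ else insert z S₁) = (if lost S₂ then S₂ else insert z S₂) at heq
    by_cases h₁ : lost S₁ <;> by_cases h₂ : lost S₂
    · rw [if_pos h₁, if_pos h₂] at heq
      exact heq
    · rw [if_pos h₁, if_neg h₂] at heq
      exact absurd (heq ▸ mem_insert_self z S₂) hz₁
    · rw [if_neg h₁, if_pos h₂] at heq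
      exact absurd (heq.symm ▸ mem_insert_self z S₁) hz₂
    · rw [if_neg h₁, if_neg h₂] at heq
      rw [← erase_insert hz₁, ← erase_insert hz₂]
      exact congrArg (fun S => S.erase z) heq
  -- disjointness from the `z`-free sets of `N ∖ z`
  have hdisj : Disjoint (levelSetCoQ (N ＼ ({z} : Set α)) t q) (T'.image f) := by
    rw [disjoint_left]
    intro S hS hS'
    rw [mem_levelSetCoQ, gr_delete'] at hS
    obtain ⟨⟨hSg, _⟩, hSc⟩ := hS
    rw [mem_image] at hS'
    obtain ⟨S', hS'T, hfS⟩ := hS'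
    change (if lost S' then S' else insert z S') = S at hfS
    by_cases hl : lost S'
    · -- a lost set has co-rank `< t` in `N ∖ z`
      rw [if_pos hl] at hfS
      subst hfS
      obtain ⟨_, hlt⟩ := hl
      have hY : (gr N).erase z \ S' ⊆ (gr N).erase z := sdiff_subset
      rw [rk_delete hY] at hSc
      omega
    · -- a set through `z` is not a set of `N ∖ z`
      rw [if_neg hl] at hfS
      subst hfS
      exact (mem_erase.1 (hSg (mem_insert_self z S'))).1 rfl
  calc (levelSetCoQ (N ＼ ({z} : Set α)) t q).card + T'.card
      = (levelSetCoQ (N ＼ ({z} : Set α)) t q).card + (T'.image f).card := by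
          rw [card_image_of_injOn hinj]
    _ = ((levelSetCoQ (N ＼ ({z} : Set α)) t q) ∪ T'.image f).card := by
          rw [card_union_of_disjoint hdisj]
    _ ≤ (levelSetCoQ N t q).card :=
          card_le_card (union_subset (levelSetCoQ_delete_subset_gen z t q) himage)

/-- **Deletion monotonicity of the threshold gap at a non-loop point generic at a level `k ≥ q − 1`, from the
family one co-rank down** (`2 ≤ q`, `q − 1 ≤ t`): `DelMonoT N z q t` follows from `(I_{t−1})` at co-rank `q − 1`
for `N ／ z`. -/
theorem delMonoT_of_genericLevel (hzI : N.Indep {z}) (hg : GenericQ N z k) (hk : q - 1 ≤ k) (hq : 2 ≤ q)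
    (hqt : q - 1 ≤ t) (h : ThresholdIneq (N ／ ({z} : Set α)) (q - 1) (t - 1)) : DelMonoT N z q t := by
  unfold DelMonoT
  rw [thresholdSum_eq_delete_add_contract_of_genericLevel hzI hg hk hq (by omega)]
  unfold ThresholdIneq at h
  have e1 : q - 1 - 1 = q - 2 := by omega
  have e2 : t - 1 + 1 = t := by omega
  have hsupply := card_levelSetCoQ_delete_add_le_of_genericLevel (t := t) hzI hg hk (by omega) (by omega)
  set L' := (Rq (N ／ ({z} : Set α)) (q - 2)).filter
    (fun B' => t ≤ rk (N ／ ({z} : Set α)) (gr (N ／ ({z} : Set α)) \ B')) with hL'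
  have hLsum : t * L'.card ≤ thresholdSum (N ／ ({z} : Set α)) (q - 1) (t - 1) := by
    unfold thresholdSum
    rw [e1, e2, hL', card_filter, mul_sum]
    refine sum_le_sum (fun B' _ => ?_)
    split_ifs <;> omega
  have hT' : L'.card ≤ (levelSetCoQ (N ／ ({z} : Set α)) (t - 1) (q - 1)).card := by
    have h3 : t * L'.card ≤ t * (levelSetCoQ (N ／ ({z} : Set α)) (t - 1) (q - 1)).card := by
      calc t * L'.card ≤ thresholdSum (N ／ ({z} : Set α)) (q - 1) (t - 1) := hLsum
        _ ≤ (q - 1) * (levelSetCoQ (N ／ ({z} : Set α)) (t - 1) (q - 1)).card := h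
        _ ≤ t * (levelSetCoQ (N ／ ({z} : Set α)) (t - 1) (q - 1)).card :=
            Nat.mul_le_mul_right _ (by omega)
    exact Nat.le_of_mul_le_mul_left h3 (by omega)
  have hA : thresholdSum (N ／ ({z} : Set α)) (q - 1) (t - 1) + L'.card ≤
      q * (levelSetCoQ (N ／ ({z} : Set α)) (t - 1) (q - 1)).card := by
    have hq1 : (q - 1) * (levelSetCoQ (N ／ ({z} : Set α)) (t - 1) (q - 1)).card +
        (levelSetCoQ (N ／ ({z} : Set α)) (t - 1) (q - 1)).card =
        q * (levelSetCoQ (N ／ ({z} : Set α)) (t - 1) (q - 1)).card := by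
      have hq' : q - 1 + 1 = q := Nat.sub_add_cancel (by omega : 1 ≤ q)
      calc (q - 1) * (levelSetCoQ (N ／ ({z} : Set α)) (t - 1) (q - 1)).card +
            (levelSetCoQ (N ／ ({z} : Set α)) (t - 1) (q - 1)).card
          = (q - 1 + 1) * (levelSetCoQ (N ／ ({z} : Set α)) (t - 1) (q - 1)).card := by ring
        _ = q * (levelSetCoQ (N ／ ({z} : Set α)) (t - 1) (q - 1)).card := by rw [hq']
    omega
  have hB : q * (levelSetCoQ (N ＼ ({z} : Set α)) t q).card +
      q * (levelSetCoQ (N ／ ({z} : Set α)) (t - 1) (q - 1)).card ≤ q * (levelSetCoQ N t q).card := by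
    rw [← Nat.mul_add]
    exact Nat.mul_le_mul_left q hsupply
  omega

/-- **`(q−1)`-genericity suffices**: `DelMonoT N z q t` at every non-loop `z` with `GenericQ N z (q − 1)` from
`(I_{t−1})` at co-rank `q − 1` for `N ／ z` (`2 ≤ q`, `q − 1 ≤ t`) — `delMonoT_of_genericQ` one level lower. -/
theorem delMonoT_of_genericQ_pred (hzI : N.Indep {z}) (hg : GenericQ N z (q - 1)) (hq : 2 ≤ q)
    (hqt : q - 1 ≤ t) (h : ThresholdIneq (N ／ ({z} : Set α)) (q - 1) (t - 1)) : DelMonoT N z q t :=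
  delMonoT_of_genericLevel hzI hg le_rfl hq hqt h

/-- The old statement is the level `k = q` of the new one. -/
theorem delMonoT_of_genericQ' (hzI : N.Indep {z}) (hg : GenericQ N z q) (hq : 2 ≤ q) (hqt : q - 1 ≤ t)
    (h : ThresholdIneq (N ／ ({z} : Set α)) (q - 1) (t - 1)) : DelMonoT N z q t :=
  delMonoT_of_genericLevel hzI hg (by omega) hq hqt h

end ThresholdGenericLevel

end PercRepro.Cogirth
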